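import Summits.AnomalousDissipation.AnomalousDissipation.Theorems.BaireTransferDenseLoudDesignerForcesErgodicModelSemigroup
import Literature.Analysis.UnboundedOperators.SemilinearMildTube

/-!
# The derivative of the model map solves the linear mild equation (registered tools stub S6d₂a
# `stub_modelDerivativeTools` of block N, line `ergodic-budget-selection-closing`, crux
# `BaireTransfer.DenseLoudDesignerForces`, stmt-AnomalousDissipation-1143)

Summit-side plumbing over the ACCEPTED definitions `ModelFrame`, `ModelFrame.IsMild`, `ModelFrame.modelMap`
(`…ErgodicModelDefs.lean`), the S6b bookkeeping of mild curves and of the model map (`…ErgodicModelSemigroup.lean`: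
the rescaled families `t ↦ F.T (νt)`, `t ↦ F.K (νt)` satisfy the hypotheses of the abstract mild theorems;
`IsMild.apply_zero`, `IsMild.restrict`, `modelMap_eq_of_isMild`), and the landed abstract tube theorem S4c
`Literature.Analysis.UnboundedOperators.exists_mildTube` (`Literature/Analysis/UnboundedOperators/SemilinearMildTube.lean`:
Henry 1981, Thm. 3.4.4 / Cor. 3.4.6 — around a reference mild curve the solution map is `C^∞` in the datum at each
time, and its derivative is continuous in time and solves the LINEARISED mild equation along the solution).

`stub_modelDerivativeTools`: let `F` be a model frame, `ν > 0`, `xF` the frame forcing, `U ⊆ U'` open, and suppose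
that from every `y ∈ U` and for every `t ∈ [0, 3]` an admissible (i.e. `U'`-valued) mild solution on `[0, t]` exists.
Then for `y ∈ U` and every direction `h`, the derivative `w(t) = D(g t)(y) h` of the model map `g := F.modelMap ν xF U'`
is continuous on `[0, 3]` and solves `w(t) = T(νt) h − ∫₀ᵗ K(ν(t − s)) (Nb(g s y, w s) + Nb(w s, g s y)) ds` there.
Proof: the admissible solution `z` on `[0, 3]` from `y` has compact range inside the open `U'`, whence `ε`-room
(`IsCompact.exists_thickening_subset_open`); the tube `Ψ` of `exists_mildTube` around `z` with this `ε` consists, for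
data `y₀` in a ball around `y`, of mild solutions staying `ε`-close to `z`, hence in `U'`, hence admissible: so
`g s y₀ = Ψ y₀ s` for `s ∈ [0, 3]` (`modelMap_eq_of_isMild` on the restrictions), the maps `g s` and `Ψ · s` agree near
`y`, their derivatives at `y` coincide (`Filter.EventuallyEq.fderiv_eq`), and the continuity and the derivative identity
of the tube transfer verbatim.

References: D. Henry, *Geometric Theory of Semilinear Parabolic Equations*, LNM 840 (1981), Thm. 3.4.4, Cor. 3.4.6.
Nothing is asserted; no definition is added.
-/

-- `Summit.<Summit>.<Problem>` is the tree's mandated summit-side namespace (CONVENTIONS §2); for this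
-- single-conjunct summit the two coincide, so the duplicate is deliberate.
set_option linter.dupNamespace false

noncomputable section

open Set Function MeasureTheory Filter
open scoped InnerProductSpace Topology

namespace Summit.AnomalousDissipation.AnomalousDissipation.Theorems.DenseLoudDesignerForces.Ergodic

open Literature.Analysis.FunctionSpaces Literature.Analysis.FunctionSpaces.Torus
open Literature.Analysis.FluidPDE Literature.Analysis.FluidPDE.Torus
open Literature.Analysis.UnboundedOperators

/-! ## From local agreement with a tube solution map to the derivative statements -/

/-- **Transfer of the derivative data of a tube to the model map.**  If near `y` and at every time of `[0, 3]` the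
model map `g := F.modelMap ν xF U'` agrees with a family `Ψ : Hsp → C([0, 3]; Hsp)` (`g s y₀ = Ψ y₀ s` for `y₀` in a
neighbourhood `V` of `y`), then `D(g s)(y) h = D(Ψ · s)(y) h` (`Filter.EventuallyEq.fderiv_eq`); so the continuity in
time of `t ↦ D(Ψ · t)(y) h` and its linearised mild identity along `Ψ y` (the conclusions of the tube theorem
`exists_mildTube`, Henry 1981, Cor. 3.4.6) are literally the corresponding statements for `g`. [folklore] -/
theorem fderiv_modelMap_of_eqOn_nhds (F : ModelFrame) {ν : ℝ} (xF : Hsp) {U' V : Set Hsp} {y : Hsp} (hV : V ∈ 𝓝 y)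
    {Ψ : Hsp → C(Icc (0 : ℝ) 3, Hsp)}
    (hagree : ∀ y₀ ∈ V, ∀ (s : ℝ) (hs : s ∈ Icc (0 : ℝ) 3), F.modelMap ν xF U' s y₀ = Ψ y₀ ⟨s, hs⟩) (h : Hsp)
    (hcont : Continuous fun t : Icc (0 : ℝ) 3 => fderiv ℝ (fun y' => Ψ y' t) y h)
    (hid : ∀ (t : ℝ) (ht : t ∈ Icc (0 : ℝ) 3), fderiv ℝ (fun y' => Ψ y' ⟨t, ht⟩) y h = F.T (ν * t) h -
      ∫ s in (0 : ℝ)..t, F.K (ν * (t - s))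
        (F.Nb (Ψ y (projIcc 0 3 zero_le_three s)) (fderiv ℝ (fun y' => Ψ y' (projIcc 0 3 zero_le_three s)) y h) +
          F.Nb (fderiv ℝ (fun y' => Ψ y' (projIcc 0 3 zero_le_three s)) y h) (Ψ y (projIcc 0 3 zero_le_three s)))) :
    ContinuousOn (fun t : ℝ => fderiv ℝ (fun y' => F.modelMap ν xF U' t y') y h) (Icc 0 3) ∧
      ∀ t ∈ Icc (0 : ℝ) 3, fderiv ℝ (fun y' => F.modelMap ν xF U' t y') y h = F.T (ν * t) h -
        ∫ s in (0 : ℝ)..t, F.K (ν * (t - s))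
          (F.Nb (F.modelMap ν xF U' s y) (fderiv ℝ (fun y' => F.modelMap ν xF U' s y') y h) +
            F.Nb (fderiv ℝ (fun y' => F.modelMap ν xF U' s y') y h) (F.modelMap ν xF U' s y)) := by
  have hy : y ∈ V := mem_of_mem_nhds hV
  -- the derivatives at `y` agree at every time of `[0, 3]`
  have hfd : ∀ (s : ℝ) (hs : s ∈ Icc (0 : ℝ) 3), fderiv ℝ (fun y' => F.modelMap ν xF U' s y') y h =
      fderiv ℝ (fun y' => Ψ y' ⟨s, hs⟩) y h := fun s hs =>
    congrArg (fun L : Hsp →L[ℝ] Hsp => L h)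
      (Filter.EventuallyEq.fderiv_eq (Filter.eventuallyEq_of_mem hV fun y₀ hy₀ => hagree y₀ hy₀ s hs))
  refine ⟨?_, fun t ht => ?_⟩
  · -- continuity on `[0, 3]` = continuity of the restriction to the subtype
    rw [continuousOn_iff_continuous_restrict]
    have heq : (Icc (0 : ℝ) 3).restrict (fun t : ℝ => fderiv ℝ (fun y' => F.modelMap ν xF U' t y') y h) =
        fun t : Icc (0 : ℝ) 3 => fderiv ℝ (fun y' => Ψ y' t) y h := funext fun t => hfd t t.2
    rw [heq]
    exact hcont
  · -- the linearised identity: the integrands agree on `[0, t]`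
    refine (hfd t ht).trans ((hid t ht).trans (congrArg (fun I : Hsp => F.T (ν * t) h - I)
      (intervalIntegral.integral_congr fun s hs => ?_)))
    rw [uIcc_of_le ht.1] at hs
    have hs' : s ∈ Icc (0 : ℝ) 3 := ⟨hs.1, hs.2.trans ht.2⟩
    -- (term-mode congruence: rewriting the integrand is expensive to type-check on `Hsp`)
    have hP : projIcc (0 : ℝ) 3 zero_le_three s = ⟨s, hs'⟩ := projIcc_of_mem zero_le_three hs'
    have ea : Ψ y (projIcc 0 3 zero_le_three s) = F.modelMap ν xF U' s y :=
      (congrArg (fun X => Ψ y X) hP).trans (hagree y hy s hs').symm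
    have eb : fderiv ℝ (fun y' => Ψ y' (projIcc 0 3 zero_le_three s)) y h =
        fderiv ℝ (fun y' => F.modelMap ν xF U' s y') y h :=
      (congrArg (fun X => fderiv ℝ (fun y' => Ψ y' X) y h) hP).trans (hfd s hs').symm
    exact congrArg (fun w => F.K (ν * (t - s)) w) (congrArg₂ (fun a b => F.Nb a b + F.Nb b a) ea eb)

/-! ## The registered tools stub -/

/-- **Tools stub S6d₂a of block N (`stub_modelDerivativeTools`) — the derivative of the model map solves the linear
mild equation along the orbit.**  Let `F` be a model frame, `ν > 0`, `xF` the frame forcing, `U ⊆ U'` open sets, and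
suppose that from every `y ∈ U` and for every `t ∈ [0, 3]` a mild solution on `[0, t]` staying in `U'` exists (and gives
the model map `g := F.modelMap ν xF U'`).  Then for `y ∈ U` and every `h`, `t ↦ D(g t)(y) h` is continuous on `[0, 3]`
and `D(g t)(y) h = T(νt) h − ∫₀ᵗ K(ν(t − s)) (Nb (g s y) (D(g s)(y) h) + Nb (D(g s)(y) h) (g s y)) ds` for `t ∈ [0, 3]`:
the model map agrees near `y`, at every time of `[0, 3]`, with the solution map of the tube of `exists_mildTube`
(Henry 1981, Cor. 3.4.6) around the admissible solution from `y` — the tube radius being the room between the compact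
range of that solution and the complement of `U'` (`IsCompact.exists_thickening_subset_open`), so that the tube
solutions are admissible and compute the model map (`modelMap_eq_of_isMild`) — and `fderiv_modelMap_of_eqOn_nhds`
transfers the tube's derivative data.  (The hypotheses `IsOpen U`, `U ⊆ U'` of the registered signature are not needed.)
[folklore] -/
theorem stub_modelDerivativeTools (F : ModelFrame) {ν : ℝ} (hν : 0 < ν) (xF : Hsp) {U U' : Set Hsp} (hU : IsOpen U) (hU' : IsOpen U')
    (hUU' : U ⊆ U')
    (htube : ∀ y ∈ U, ∀ t ∈ Icc (0 : ℝ) 3, ∃ (ht : 0 ≤ t) (z : C(Icc (0 : ℝ) t, Hsp)),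
      F.IsMild ν xF ht y z ∧ (∀ r, z r ∈ U') ∧ F.modelMap ν xF U' t y = z ⟨t, ht, le_rfl⟩) :
    ∀ y ∈ U, ∀ h : Hsp,
      ContinuousOn (fun t : ℝ => fderiv ℝ (fun y' => F.modelMap ν xF U' t y') y h) (Icc 0 3) ∧
      ∀ t ∈ Icc (0 : ℝ) 3, fderiv ℝ (fun y' => F.modelMap ν xF U' t y') y h = F.T (ν * t) h -
        ∫ s in (0 : ℝ)..t, F.K (ν * (t - s))
          (F.Nb (F.modelMap ν xF U' s y) (fderiv ℝ (fun y' => F.modelMap ν xF U' s y') y h) +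
            F.Nb (fderiv ℝ (fun y' => F.modelMap ν xF U' s y') y h) (F.modelMap ν xF U' s y)) := by
  -- the openness of `U` and `U ⊆ U'` are part of the registered interface; they are not needed here
  have _ : IsOpen U ∧ U ⊆ U' := ⟨hU, hUU'⟩
  intro y hy h
  have h03 : (0 : ℝ) ≤ 3 := zero_le_three
  have h3 : (0 : ℝ) < 3 := zero_lt_three
  have hα : (3 / 4 : ℝ) < 1 := by norm_num
  have hC : 0 ≤ ν ^ (-(3 / 4 : ℝ)) := Real.rpow_nonneg hν.le _
  -- (1) the admissible solution `z` on `[0, 3]` from `y`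
  obtain ⟨ht3, z, hz, hzU', -⟩ := htube y hy 3 (right_mem_Icc.2 h03)
  have hz0 : z ⟨0, le_rfl, h3.le⟩ = y := hz.apply_zero
  -- (2) room between the compact range of `z` and the complement of the open `U'`
  obtain ⟨ε, hε, hεU'⟩ := (isCompact_range z.continuous).exists_thickening_subset_open hU'
    (range_subset_iff.2 hzU')
  -- (3) the tube of S4c around `z` with this room
  obtain ⟨δ, hδ, Lip, Ψ, hΨ⟩ := exists_mildTube (fun t => F.T (ν * t)) (fun t => F.K (ν * t))
    (F.T_mul_zero ν) (F.T_mul_add hν.le) (F.norm_T_mul_le hν.le) (F.continuous_T_mul ν) hα hC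
    (F.norm_K_mul_le hν) (F.K_mul_add hν) (F.continuousOn_K_mul hν) F.Nb xF h3 z
    (fun t => by rw [hz0]; exact hz t) hε
  have hball : ∀ y₀ ∈ Metric.ball y δ, y₀ ∈ Metric.ball (z ⟨0, le_rfl, h3.le⟩) δ := fun y₀ hy₀ => by
    rwa [hz0]
  have hyδ : y ∈ Metric.ball y δ := Metric.mem_ball_self hδ
  -- (4) local agreement of the model map with the tube solution map: tube solutions are admissible
  have hagree : ∀ y₀ ∈ Metric.ball y δ, ∀ (s : ℝ) (hs : s ∈ Icc (0 : ℝ) 3),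
      F.modelMap ν xF U' s y₀ = Ψ y₀ ⟨s, hs⟩ := by
    intro y₀ hy₀ s hs
    obtain ⟨hm, htb, -⟩ := hΨ.2.2 y₀ (hball y₀ hy₀)
    have hmild : F.IsMild ν xF h03 y₀ (Ψ y₀) := hm
    have hin : ∀ r, Ψ y₀ r ∈ U' := fun r =>
      hεU' (Metric.mem_thickening_iff.2 ⟨z r, mem_range_self r, by rw [dist_eq_norm]; exact (htb r).2⟩)
    obtain ⟨z', hz', hz'eq⟩ := hmild.restrict hs.1 hs.2
    rw [F.modelMap_eq_of_isMild hν hs.1 hz' fun r => by rw [hz'eq r]; exact hin _, hz'eq]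
  -- (5) transfer of the continuity and of the linearised identity of the tube derivative
  have hder := (hΨ.2.2 y (hball y hyδ)).2.2 h
  exact fderiv_modelMap_of_eqOn_nhds F xF (Metric.isOpen_ball.mem_nhds hyδ) hagree h hder.1 fun t ht =>
    hder.2 ⟨t, ht⟩

end Summit.AnomalousDissipation.AnomalousDissipation.Theorems.DenseLoudDesignerForces.Ergodic

end
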